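import Summits.QuantumFields.YangMills.Theorems.BalabanUVNodesN15KingModelTwoPointThermodynamicLimit

/-!
# BalabanUVNodes ∕ N15 — THE KING-MODEL RUNG (PART Ϝ-l): THE JOINT LIMIT `K → ∞`, `|Ω| → ∞` OF THE BLOCK-SMEARED TWO-POINT FUNCTION —
# `S₂^{(K_k)}_{Ω_k}(0, z) → S₂^{ℝ}(z)` along ANY sequence with `K_k → ∞` and all periods `M_{k,ν} → ∞` (the (4.38) rate is uniform in the volume, so the limits commute)
# (Track A, DAG node N15 = NE2; FAN-OUT v1.1 §N15 s3 «KING-MODEL RUNG … NE2's analogue DECIDED in the model»)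

HONEST FRAMING.  Count-neutral (cell `pub-ymgap`, seat `pub-ymgap-dag-n15-e` g33; `--supports stmt-QuantumFields-27366 --as helper` = K3⁸
`SpineGivenEndpointR13SepCoPHV`).  TEMPLATE LITERATURE: C. King, *The U(1) Higgs model. I. The continuum limit*, Commun. Math. Phys. **102** (1986) 649–677
[King1986] — KING's OWN `A = 0`, `g = 0` MODEL.  Part Ϝ-d: at fixed volume `S₂^{(K)}_Ω → S₂^{(∞)}_Ω` with the (4.38)-shape rate `(2C_diff + a_∞⁻¹)e^{−(κ_M∕2)d_T}L^{−K}` whose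
constants do NOT depend on `Ω`; part Ϝ-j: `S₂^{(∞)}_Ω(0, z) → S₂^{ℝ}(z)` as all periods `→ ∞`.  Uniformity makes the double limit a JOINT limit.  NOT the interacting model
([King1986II]); NOT Bałaban's objects; NOT a node discharge (N15 is booked through n15-a's knit, untouched here); nothing continuum-Yang–Mills ∕ ℝ⁴ ∕ OS ∕ mass-gap ∕ Clay.
0 `sorry`; standard axioms; 0 `def`.

THE MATHEMATICS.  `|S₂^{(K)}_Ω(0,z) − S₂^{ℝ}(z)| ≤ |S₂^{(K)}_Ω − S₂^{(∞)}_Ω|(0,z) + |S₂^{(∞)}_Ω(0,z) − S₂^{ℝ}(z)| ≤ C·L^{−K} + o_Ω(1)` with `C = 2C_diff + a_∞⁻¹` volume-free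
(`e^{−(κ∕2)d_T} ≤ 1`).  Hence: (i) for every fixed `K ≥ 1`, along tori with all periods `→ ∞`, EVENTUALLY `|S₂^{(K)}_{Ω_k}(0,z) − S₂^{ℝ}(z)| ≤ C·L^{−K} + ε` (every `ε > 0`) —
the finite-`K` kernels are asymptotically `ε_K`-close to the infinite-volume continuum kernel; (ii) along ANY joint sequence `(K_k, Ω_k)` with `K_k → ∞` and all periods `→ ∞`,
`S₂^{(K_k)}_{Ω_k}(0,z) → S₂^{ℝ}(z)`; (iii) the same for NE2's unit kernel: `(Δ^{(K_k)})⁻¹_{Ω_k}(0,z) → S₂^{ℝ}(z) + a_∞⁻¹[z = 0]` (part Ϡ-e's uniform rate + part Ϝ-j §6).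

WHAT THIS FILE PROVES (kernel).  `abs_kingS2_sub_lim_le_unif` (the volume-free form of Ϝ-d's rate), ★★ **`eventually_abs_kingS2_sub_kingS2Inf_le`** ((i)), ★★★ **`tendsto_kingS2_joint`** ((ii)),
`abs_blockCov_sub_lim_le_unif`, ★★ **`tendsto_blockCov_joint`** ((iii)).

HONEST SCOPE.  Free field; unit-block smearing; `m² > 0`; auxiliary `a > 0`, odd `L ≥ 3` de facto.  N15 untouched; counts unmoved.
Locators: [King1986] Thm 2.1 (2.22) p.654, Lemma 4.5 (4.38) p.674, (2.14) p.653.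
-/

noncomputable section

open scoped BigOperators
open Finset Filter Topology

namespace Summit.QuantumFields.YangMills.BalabanUVNodes.N15KingModelRung

open Literature.MathematicalPhysics.QuantumFieldTheory.Balaban1983to89.B5Prop11Plancherel (Tor fine chi sOf)
open Literature.MathematicalPhysics.QuantumFieldTheory.King1986 (aK aK_pos)
open Literature.MathematicalPhysics.QuantumFieldTheory.King1986.Torus

variable {d : ℕ}

/-! ## §1 The volume-free rate and the asymptotic closeness at fixed `K` -/

/-- The (4.38) rate of part Ϝ-d with the distance factor dropped: `|S₂^{(K)}_Ω(b,b′) − S₂^{(∞)}_Ω(b,b′)| ≤ (2C_diff + a_∞⁻¹)·L^{−K}`, the SAME constant for every unit torus.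
[cite: King1986, Lemma 4.5 (4.38) p.674] -/
theorem abs_kingS2_sub_lim_le_unif (L : ℕ) (M : Fin (d + 1) → ℕ) [∀ ν, NeZero (M ν)] (hLodd : Odd L) (hL : 2 ≤ L) {a m2 : ℝ} (ha : 0 < a) (hm : 0 < m2)
    {K : ℕ} (hK : 1 ≤ K) (b b' : Tor M) :
    haveI : NeZero L := ⟨by omega⟩
    |kingS2 (L ^ K) M m2 b b' - kingS2Lim M m2 b b'| ≤ (2 * CdiffM (d + 1) a m2 L + (aInf a L)⁻¹) * ((L : ℝ) ^ K)⁻¹ := by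
  haveI : NeZero L := ⟨by omega⟩
  have hL1 : (1 : ℝ) < L := by exact_mod_cast (show 1 < L by omega)
  have hC : 0 ≤ 2 * CdiffM (d + 1) a m2 L + (aInf a L)⁻¹ := by
    have := CdiffM_nonneg (d := d + 1) ha hm hL; have := aInf_pos ha hL1; positivity
  have h := abs_kingS2_sub_lim_le L M hLodd hL ha hm hK b b'
  have hexp : Real.exp (-(kapM (d + 1) a m2 L / 2 * tdistT M b b')) ≤ 1 := by
    rw [Real.exp_le_one_iff, neg_nonpos]
    exact mul_nonneg (half_pos (kapM_pos_le (d := d + 1) ha hm hL).1).le (tdistT_nonneg M b b')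
  calc _ ≤ (2 * CdiffM (d + 1) a m2 L + (aInf a L)⁻¹) * Real.exp (-(kapM (d + 1) a m2 L / 2 * tdistT M b b')) * ((L : ℝ) ^ K)⁻¹ := h
    _ ≤ (2 * CdiffM (d + 1) a m2 L + (aInf a L)⁻¹) * 1 * ((L : ℝ) ^ K)⁻¹ := by gcongr
    _ = _ := by rw [mul_one]

/-- ★★ **FINITE-`K` KERNELS ARE ASYMPTOTICALLY `ε_K`-CLOSE TO THE INFINITE-VOLUME CONTINUUM KERNEL**: for `K ≥ 1`, every `ε > 0`, along any tori with all periods `→ ∞`: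
eventually `|S₂^{(K)}_{Ω_k}(0, z mod M_k) − S₂^{ℝ}(z)| ≤ (2C_diff + a_∞⁻¹)·L^{−K} + ε`. [cite: King1986, Thm 2.1 (2.22) p.654, Lemma 4.5 (4.38) p.674] -/
theorem eventually_abs_kingS2_sub_kingS2Inf_le (L : ℕ) (hLodd : Odd L) (hL : 2 ≤ L) {a m2 : ℝ} (ha : 0 < a) (hm : 0 < m2) {K : ℕ} (hK : 1 ≤ K)
    (Mseq : ℕ → Fin (d + 1) → ℕ) (hpos : ∀ k ν, 0 < Mseq k ν) (hlim : ∀ ν, Tendsto (fun k => (Mseq k ν : ℝ)) atTop atTop)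
    (z : Fin (d + 1) → ℤ) {ε : ℝ} (hε : 0 < ε) :
    haveI : NeZero L := ⟨by omega⟩
    ∀ᶠ k in atTop, haveI : ∀ ν, NeZero (Mseq k ν) := fun ν => ⟨(hpos k ν).ne'⟩
      |kingS2 (L ^ K) (Mseq k) m2 0 (fun ν => ((z ν : ℤ) : ZMod (Mseq k ν))) - kingS2Inf m2 z|
        ≤ (2 * CdiffM (d + 1) a m2 L + (aInf a L)⁻¹) * ((L : ℝ) ^ K)⁻¹ + ε := by
  haveI : NeZero L := ⟨by omega⟩
  have hlimS := tendsto_kingS2Lim_volume hm Mseq hpos hlim z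
  have hev := (Metric.tendsto_nhds.mp hlimS) ε hε
  filter_upwards [hev] with k hk
  haveI : ∀ ν, NeZero (Mseq k ν) := fun ν => ⟨(hpos k ν).ne'⟩
  rw [Real.dist_eq] at hk
  have h1 := abs_kingS2_sub_lim_le_unif L (Mseq k) hLodd hL ha hm hK 0 (fun ν => ((z ν : ℤ) : ZMod (Mseq k ν)))
  calc |kingS2 (L ^ K) (Mseq k) m2 0 (fun ν => ((z ν : ℤ) : ZMod (Mseq k ν))) - kingS2Inf m2 z|
      ≤ |kingS2 (L ^ K) (Mseq k) m2 0 (fun ν => ((z ν : ℤ) : ZMod (Mseq k ν))) - kingS2Lim (Mseq k) m2 0 (fun ν => ((z ν : ℤ) : ZMod (Mseq k ν)))|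
        + |kingS2Lim (Mseq k) m2 0 (fun ν => ((z ν : ℤ) : ZMod (Mseq k ν))) - kingS2Inf m2 z| := abs_sub_le _ _ _
    _ ≤ (2 * CdiffM (d + 1) a m2 L + (aInf a L)⁻¹) * ((L : ℝ) ^ K)⁻¹ + ε := add_le_add h1 hk.le

/-! ## §2 The joint limit -/

/-- ★★★ **THE JOINT LIMIT (the continuum and thermodynamic limits commute for the free two-point function)**: for odd `L ≥ 2`, `m² > 0`, every `z ∈ ℤ^{d+1}` and ANY sequence
`(K_k, Ω_k)` with `K_k → ∞` and all periods `M_{k,ν} → ∞`: `S₂^{(K_k)}_{Ω_k}(0, z mod M_k) → S₂^{ℝ}(z)`. [cite: King1986, Thm 2.1 (2.22) p.654, Lemma 4.5 (4.38) p.674] -/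
theorem tendsto_kingS2_joint (L : ℕ) (hLodd : Odd L) (hL : 2 ≤ L) {m2 : ℝ} (hm : 0 < m2) (Kseq : ℕ → ℕ) (hK : Tendsto Kseq atTop atTop)
    (Mseq : ℕ → Fin (d + 1) → ℕ) (hpos : ∀ k ν, 0 < Mseq k ν) (hlim : ∀ ν, Tendsto (fun k => (Mseq k ν : ℝ)) atTop atTop) (z : Fin (d + 1) → ℤ) :
    haveI : NeZero L := ⟨by omega⟩
    Tendsto (fun k => haveI : ∀ ν, NeZero (Mseq k ν) := fun ν => ⟨(hpos k ν).ne'⟩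
      kingS2 (L ^ Kseq k) (Mseq k) m2 0 (fun ν => ((z ν : ℤ) : ZMod (Mseq k ν)))) atTop (𝓝 (kingS2Inf m2 z)) := by
  haveI : NeZero L := ⟨by omega⟩
  have hL1 : (1 : ℝ) < L := by exact_mod_cast (show 1 < L by omega)
  -- the first summand → 0 (uniform rate, `K_k → ∞`), the second → 0 (thermodynamic limit)
  have hrate : Tendsto (fun k => (2 * CdiffM (d + 1) 1 m2 L + (aInf 1 L)⁻¹) * ((L : ℝ) ^ Kseq k)⁻¹) atTop (𝓝 0) := by
    have h0 : Tendsto (fun K : ℕ => ((L : ℝ) ^ K)⁻¹) atTop (𝓝 0) := by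
      simpa only [← inv_pow] using tendsto_pow_atTop_nhds_zero_of_lt_one (by positivity) (inv_lt_one_of_one_lt₀ hL1)
    simpa using (h0.comp hK).const_mul (2 * CdiffM (d + 1) 1 m2 L + (aInf 1 L)⁻¹)
  have hlimS := tendsto_kingS2Lim_volume hm Mseq hpos hlim z
  rw [tendsto_iff_norm_sub_tendsto_zero]
  have hsum := hrate.add (tendsto_iff_norm_sub_tendsto_zero.mp hlimS)
  rw [add_zero] at hsum
  refine squeeze_zero' (Filter.Eventually.of_forall fun k => norm_nonneg _) ?_ hsum
  filter_upwards [hK.eventually_ge_atTop 1] with k hk1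
  haveI : ∀ ν, NeZero (Mseq k ν) := fun ν => ⟨(hpos k ν).ne'⟩
  simp only [Real.norm_eq_abs]
  have h1 := abs_kingS2_sub_lim_le_unif L (Mseq k) hLodd hL one_pos hm hk1 0 (fun ν => ((z ν : ℤ) : ZMod (Mseq k ν)))
  have h2 := abs_sub_le (kingS2 (L ^ Kseq k) (Mseq k) m2 0 (fun ν => ((z ν : ℤ) : ZMod (Mseq k ν))))
    (kingS2Lim (Mseq k) m2 0 (fun ν => ((z ν : ℤ) : ZMod (Mseq k ν)))) (kingS2Inf m2 z)
  linarith

/-! ## §3 The same for NE2's unit kernel `(Δ^{(K)})⁻¹` -/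

/-- Part Ϡ-e's (4.38) rate with the distance factor dropped: `|(Δ^{(K)})⁻¹_Ω(b,b′) − C^{(∞)}_Ω(b,b′)| ≤ 2C_diff·L^{−K}`, the SAME constant for every unit torus.
[cite: King1986, Lemma 4.5 (4.38) p.674] -/
theorem abs_blockCov_sub_lim_le_unif (L : ℕ) (M : Fin (d + 1) → ℕ) [∀ ν, NeZero (M ν)] (hLodd : Odd L) (hL : 2 ≤ L) {a m2 : ℝ} (ha : 0 < a) (hm : 0 < m2)
    {K : ℕ} (hK : 1 ≤ K) (b b' : Tor M) :
    haveI : NeZero L := ⟨by omega⟩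
    |blockCov L (L ^ K) M a m2 K b b' - blockCovLim L M a m2 b b'| ≤ 2 * CdiffM (d + 1) a m2 L * ((L : ℝ) ^ K)⁻¹ := by
  haveI : NeZero L := ⟨by omega⟩
  have hC : 0 ≤ 2 * CdiffM (d + 1) a m2 L := by have := CdiffM_nonneg (d := d + 1) ha hm hL; positivity
  have h := abs_blockCov_sub_lim_le L M hLodd hL ha hm hK b b'
  have hexp : Real.exp (-(kapM (d + 1) a m2 L / 2 * tdistT M b b')) ≤ 1 := by
    rw [Real.exp_le_one_iff, neg_nonpos]
    exact mul_nonneg (half_pos (kapM_pos_le (d := d + 1) ha hm hL).1).le (tdistT_nonneg M b b')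
  calc _ ≤ 2 * CdiffM (d + 1) a m2 L * Real.exp (-(kapM (d + 1) a m2 L / 2 * tdistT M b b')) * ((L : ℝ) ^ K)⁻¹ := h
    _ ≤ 2 * CdiffM (d + 1) a m2 L * 1 * ((L : ℝ) ^ K)⁻¹ := by gcongr
    _ = _ := by rw [mul_one]

/-- ★★ **THE JOINT LIMIT FOR NE2's UNIT KERNEL**: along any `(K_k, Ω_k)` with `K_k → ∞` and all periods `→ ∞`, `(Δ^{(K_k)})⁻¹_{Ω_k}(0, z mod M_k) → S₂^{ℝ}(z) + a_∞⁻¹[z = 0]`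
(`a, m² > 0`). [cite: King1986, (2.14) p.653, Thm 2.1 (2.22) p.654, Lemma 4.5 (4.38) p.674] -/
theorem tendsto_blockCov_joint (L : ℕ) (hLodd : Odd L) (hL : 2 ≤ L) {a m2 : ℝ} (ha : 0 < a) (hm : 0 < m2) (Kseq : ℕ → ℕ) (hK : Tendsto Kseq atTop atTop)
    (Mseq : ℕ → Fin (d + 1) → ℕ) (hpos : ∀ k ν, 0 < Mseq k ν) (hlim : ∀ ν, Tendsto (fun k => (Mseq k ν : ℝ)) atTop atTop) (z : Fin (d + 1) → ℤ) :
    haveI : NeZero L := ⟨by omega⟩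
    Tendsto (fun k => haveI : ∀ ν, NeZero (Mseq k ν) := fun ν => ⟨(hpos k ν).ne'⟩
      blockCov L (L ^ Kseq k) (Mseq k) a m2 (Kseq k) 0 (fun ν => ((z ν : ℤ) : ZMod (Mseq k ν)))) atTop
      (𝓝 (kingS2Inf m2 z + (aInf a L)⁻¹ * (if z = 0 then 1 else 0))) := by
  haveI : NeZero L := ⟨by omega⟩
  have hL1 : (1 : ℝ) < L := by exact_mod_cast (show 1 < L by omega)
  have hrate : Tendsto (fun k => (2 * CdiffM (d + 1) a m2 L) * ((L : ℝ) ^ Kseq k)⁻¹) atTop (𝓝 0) := by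
    have h0 : Tendsto (fun K : ℕ => ((L : ℝ) ^ K)⁻¹) atTop (𝓝 0) := by
      simpa only [← inv_pow] using tendsto_pow_atTop_nhds_zero_of_lt_one (by positivity) (inv_lt_one_of_one_lt₀ hL1)
    simpa using (h0.comp hK).const_mul (2 * CdiffM (d + 1) a m2 L)
  have hlimC := tendsto_blockCovLim_volume L (a := a) hm Mseq hpos hlim z
  rw [tendsto_iff_norm_sub_tendsto_zero]
  have hsum := hrate.add (tendsto_iff_norm_sub_tendsto_zero.mp hlimC)
  rw [add_zero] at hsum
  refine squeeze_zero' (Filter.Eventually.of_forall fun k => norm_nonneg _) ?_ hsum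
  filter_upwards [hK.eventually_ge_atTop 1] with k hk1
  haveI : ∀ ν, NeZero (Mseq k ν) := fun ν => ⟨(hpos k ν).ne'⟩
  simp only [Real.norm_eq_abs]
  have h1 := abs_blockCov_sub_lim_le_unif L (Mseq k) hLodd hL ha hm hk1 0 (fun ν => ((z ν : ℤ) : ZMod (Mseq k ν)))
  have h2 := abs_sub_le (blockCov L (L ^ Kseq k) (Mseq k) a m2 (Kseq k) 0 (fun ν => ((z ν : ℤ) : ZMod (Mseq k ν))))
    (blockCovLim L (Mseq k) a m2 0 (fun ν => ((z ν : ℤ) : ZMod (Mseq k ν)))) (kingS2Inf m2 z + (aInf a L)⁻¹ * (if z = 0 then 1 else 0))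
  linarith

end Summit.QuantumFields.YangMills.BalabanUVNodes.N15KingModelRung

end
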